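import Literature.Probability.Percolation.TriExplorationPolygon
import Literature.Probability.Percolation.TriSepProbEstimates
import HarnessLib

/-!
# The polygon of a site-percolation interface loop: crossed darts, side segments, left chains

Topic: Probability / Percolation. The twin, for the **interface loops** of critical site
percolation on `δ𝕋` (`IsSiteInterfaceLoop`, `CLE6.lean`: cycles of the hexagonal lattice with an
open site on the left and a closed site on the right of every dart; Camia–Newman, Comm. Math.
Phys. 268 (2006), §4: cluster boundaries as simple loops of the hexagonal lattice), of the
exploration-path bookkeeping of `TriExplorationPolygon.lean` (there for `IsExplorationPath` in a
Dobrushin domain). It is the deterministic lattice input of the multiple-traversal estimate for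
the loop ensemble (`isTightLaws_map_triLoopCollection`, Aizenman–Burchard, Duke Math. J. 99
(1999), App. A). For a cycle `w` with `hw : IsSiteInterfaceLoop ω w` we fix, for every step
`i < w.length`, the crossed dart `lv i → rv i` of `𝕋` (left site open, right site closed), its
side index (`w.getVert (i+1) = oppFace (w.getVert i) (sideIdx i)`), and at mesh `δ` the side
points `leftPt δ i`, `rightPt δ i` and the side segment `sideSeg δ i`, which the `i`-th dart piece
crosses at their common midpoint `δ · midpoint (centre i) (centre (i+1))`. Proved here:

* the crossed edge of step `i` is the only unit edge of `δ𝕋` meeting the `i`-th piece; lattice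
  points, open–open edges and the side segments of other steps miss the trace; the `i`-th piece
  meets its side segment only at the midpoint (`eq_midpoint_of_mem_polyPiece_of_mem_sideSeg`), so
  the half side from the left point to the midpoint is off the trace except at the midpoint
  (`not_mem_polyTrace_of_mem_segment_leftPt`);
* consecutive left sites are equal or adjacent, so the left points of a stretch whose
  `δ`-neighbourhoods stay in a set `A` lie in one component of `A` minus the trace
  (`leftPt_mem_connectedComponentIn`);
* metric bookkeeping (pieces, side points within `δ`);
* transversality signs for the side functional `segSide (leftPt i) (rightPt i)`: positive at the
  `i`-th vertex and at the previous one, negative at the next two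
  (`segSide_polyPt_pos`, `segSide_polyPt_succ_neg`, `segSide_polyPt_pred_pos`,
  `segSide_polyPt_succ_succ_neg`) — used downstream to locate `midPt` on a traversing arc by the
  intermediate value theorem.

Everything is proved; no new named facts.

## References

* F. Camia, C. M. Newman, Comm. Math. Phys. 268 (2006), §4 [CamiaNewman2006].
* M. Aizenman, A. Burchard, Duke Math. J. 99 (1999), Appendix A [AizenmanBurchardDuke1999].
* S. Smirnov, C. R. Acad. Sci. Paris 333 (2001), §2 (open hexagons on the left of the interface).
-/

noncomputable section

open Set Metric Complex
open scoped Pointwise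

namespace Literature.Probability.Percolation

open LatticeModels Literature.Topology.PlaneTopology

section Steps

variable {ω : SiteConfig (Site 2)} {f₀ : HexVertex} {w : hexGraph.Walk f₀ f₀}

/-! ### The crossed darts of the steps -/

/-- The `i`-th step of an interface loop has an open site on its left and a closed site on its
right (Camia–Newman 2006, §4). [cite: CamiaNewman2006, §4] -/
theorem IsSiteInterfaceLoop.step_getVert (hw : IsSiteInterfaceLoop ω w) {i : ℕ} (hi : i < w.length) :
    ∃ e : triGraph.Dart, triEdgeFaces e = (w.getVert (i + 1), w.getVert i) ∧ e.fst ∈ ω ∧ e.snd ∉ ω := by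
  have hi' : i < w.darts.length := by rw [SimpleGraph.Walk.length_darts]; exact hi
  have h := hw.2 _ (List.getElem_mem hi')
  rw [SimpleGraph.Walk.darts_getElem_eq_getVert i hi'] at h
  exact h

/-- The **left site** of the `i`-th step (open): the tail of the crossed dart of `𝕋`, by choice
(junk `0` past the end). (Smirnov 2001, §2; Camia–Newman 2006, §4.) [cite: CamiaNewman2006, §4] -/
def IsSiteInterfaceLoop.lv (hw : IsSiteInterfaceLoop ω w) (i : ℕ) : Site 2 :=
  if hi : i < w.length then (hw.step_getVert hi).choose.fst else 0

/-- The **right site** of the `i`-th step (closed): the head of the crossed dart of `𝕋` (junk `0`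
past the end). [cite: CamiaNewman2006, §4] -/
def IsSiteInterfaceLoop.rv (hw : IsSiteInterfaceLoop ω w) (i : ℕ) : Site 2 :=
  if hi : i < w.length then (hw.step_getVert hi).choose.snd else 0

variable (hw : IsSiteInterfaceLoop ω w)

/-- The defining properties of the crossed dart of the `i`-th step: `lv i ∼ rv i`, its left and
right faces are `w.getVert (i+1)` and `w.getVert i`, `lv i` is open and `rv i` is closed.
[cite: CamiaNewman2006, §4] -/
theorem IsSiteInterfaceLoop.dart_spec {i : ℕ} (hi : i < w.length) :
    ∃ h : triGraph.Adj (hw.lv i) (hw.rv i),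
      triEdgeFaces ⟨(hw.lv i, hw.rv i), h⟩ = (w.getVert (i + 1), w.getVert i) ∧
      hw.lv i ∈ ω ∧ hw.rv i ∉ ω := by
  have hs := (hw.step_getVert hi).choose_spec
  set e := (hw.step_getVert hi).choose with he
  have hl : hw.lv i = e.fst := by
    simp only [IsSiteInterfaceLoop.lv, dif_pos hi]; rfl
  have hr : hw.rv i = e.snd := by
    simp only [IsSiteInterfaceLoop.rv, dif_pos hi]; rfl
  have hadj : triGraph.Adj (hw.lv i) (hw.rv i) := by rw [hl, hr]; exact e.adj
  refine ⟨hadj, ?_, by rw [hl]; exact hs.2.1, by rw [hr]; exact hs.2.2⟩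
  have : (⟨(hw.lv i, hw.rv i), hadj⟩ : triGraph.Dart) = e :=
    SimpleGraph.Dart.ext _ _ (Prod.ext hl hr)
  rw [this]
  exact hs.1

/-- `lv i` and `rv i` are adjacent in `𝕋`. [cite: CamiaNewman2006, §4] -/
theorem IsSiteInterfaceLoop.adj_lv_rv {i : ℕ} (hi : i < w.length) : triGraph.Adj (hw.lv i) (hw.rv i) :=
  (hw.dart_spec hi).1

/-- The left site is open. [cite: CamiaNewman2006, §4] -/
theorem IsSiteInterfaceLoop.lv_mem {i : ℕ} (hi : i < w.length) : hw.lv i ∈ ω :=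
  (hw.dart_spec hi).2.2.1

/-- The right site is closed. [cite: CamiaNewman2006, §4] -/
theorem IsSiteInterfaceLoop.rv_not_mem {i : ℕ} (hi : i < w.length) : hw.rv i ∉ ω :=
  (hw.dart_spec hi).2.2.2

/-- Left and right sites differ (one is open, the other closed). [cite: CamiaNewman2006, §4] -/
theorem IsSiteInterfaceLoop.lv_ne_rv {i j : ℕ} (hi : i < w.length) (hj : j < w.length) :
    hw.lv i ≠ hw.rv j := fun h ↦
  hw.rv_not_mem hj (h ▸ hw.lv_mem hi)

/-- **The side index of the `i`-th step**: `w.getVert (i+1) = oppFace (w.getVert i) J`,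
`rv i = faceVertex (w.getVert i) (J+1)`, `lv i = faceVertex (w.getVert i) (J+2)`. [folklore] -/
theorem IsSiteInterfaceLoop.exists_sideIdx {i : ℕ} (hi : i < w.length) :
    ∃ J : Fin 3, w.getVert (i + 1) = oppFace (w.getVert i) J ∧
      hw.rv i = faceVertex (w.getVert i) (J + 1) ∧ hw.lv i = faceVertex (w.getVert i) (J + 2) := by
  obtain ⟨h, hfaces, -, -⟩ := hw.dart_spec hi
  obtain ⟨J, h1, h2, h3⟩ := exists_sideIdx_of_triEdgeFaces h
  have hR : (triEdgeFaces ⟨(hw.lv i, hw.rv i), h⟩).2 = w.getVert i := congrArg Prod.snd hfaces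
  have hL : (triEdgeFaces ⟨(hw.lv i, hw.rv i), h⟩).1 = w.getVert (i + 1) := congrArg Prod.fst hfaces
  rw [hR] at h1 h2 h3
  rw [hL] at h1
  exact ⟨J, h1, h2, h3⟩

/-- The side index of the `i`-th step (by choice; junk `0` past the end). [folklore] -/
def IsSiteInterfaceLoop.sideIdx (i : ℕ) : Fin 3 :=
  if hi : i < w.length then (hw.exists_sideIdx hi).choose else 0

/-- The next face is the opposite face across the side `sideIdx i`. [folklore] -/
theorem IsSiteInterfaceLoop.getVert_succ_eq {i : ℕ} (hi : i < w.length) :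
    w.getVert (i + 1) = oppFace (w.getVert i) (hw.sideIdx i) := by
  have := (hw.exists_sideIdx hi).choose_spec.1
  simp only [IsSiteInterfaceLoop.sideIdx, dif_pos hi]
  exact this

/-- The right site is the vertex `sideIdx i + 1` of the current face. [folklore] -/
theorem IsSiteInterfaceLoop.rv_eq {i : ℕ} (hi : i < w.length) :
    hw.rv i = faceVertex (w.getVert i) (hw.sideIdx i + 1) := by
  have := (hw.exists_sideIdx hi).choose_spec.2.1
  simp only [IsSiteInterfaceLoop.sideIdx, dif_pos hi]
  exact this

/-- The left site is the vertex `sideIdx i + 2` of the current face. [folklore] -/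
theorem IsSiteInterfaceLoop.lv_eq {i : ℕ} (hi : i < w.length) :
    hw.lv i = faceVertex (w.getVert i) (hw.sideIdx i + 2) := by
  have := (hw.exists_sideIdx hi).choose_spec.2.2
  simp only [IsSiteInterfaceLoop.sideIdx, dif_pos hi]
  exact this

/-! ### Consecutive left sites -/

/-- The left site is a vertex of the next face as well. [folklore] -/
theorem IsSiteInterfaceLoop.lv_mem_hexFaceVertices_succ {i : ℕ} (hi : i < w.length) :
    hw.lv i ∈ hexFaceVertices (w.getVert (i + 1)) := by
  rw [hw.getVert_succ_eq hi, hw.lv_eq hi, ← faceVertex_oppFace_succ]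
  exact faceVertex_mem _ _

/-- The left site is a vertex of the current face. [folklore] -/
theorem IsSiteInterfaceLoop.lv_mem_hexFaceVertices {i : ℕ} (hi : i < w.length) :
    hw.lv i ∈ hexFaceVertices (w.getVert i) := by
  rw [hw.lv_eq hi]; exact faceVertex_mem _ _

/-- **Consecutive left sites are equal or adjacent** (both are vertices of the face in
between): the open hexagons on the left of an interface form a connected chain
(Smirnov 2001, §2; Camia–Newman 2006, §4). [cite: CamiaNewman2006, §4] -/
theorem IsSiteInterfaceLoop.lv_succ_eq_or_adj {i : ℕ} (hi : i + 1 < w.length) :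
    hw.lv (i + 1) = hw.lv i ∨ triGraph.Adj (hw.lv i) (hw.lv (i + 1)) := by
  by_cases h : hw.lv (i + 1) = hw.lv i
  · exact Or.inl h
  · exact Or.inr (adj_of_mem_hexFaceVertices (hw.lv_mem_hexFaceVertices_succ (by omega))
      (hw.lv_mem_hexFaceVertices hi) (Ne.symm h))

/-- **Distinct steps cross distinct edges**: two steps with the same left and right sites have
the same right face, hence coincide (the faces of a cycle before the last are distinct).
[folklore] -/
theorem IsSiteInterfaceLoop.eq_of_lv_eq_of_rv_eq {i m : ℕ} (hi : i < w.length) (hm : m < w.length)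
    (hl : hw.lv i = hw.lv m) (hr : hw.rv i = hw.rv m) : i = m := by
  obtain ⟨h, hfi, -⟩ := hw.dart_spec hi
  obtain ⟨h', hfm, -⟩ := hw.dart_spec hm
  have hd : (⟨(hw.lv i, hw.rv i), h⟩ : triGraph.Dart) = ⟨(hw.lv m, hw.rv m), h'⟩ :=
    SimpleGraph.Dart.ext _ _ (Prod.ext hl hr)
  have : w.getVert i = w.getVert m := by
    have := congrArg Prod.snd (hfi.symm.trans ((congrArg triEdgeFaces hd).trans hfm))
    exact this
  exact hw.isCycle.getVert_injOn' (by simp only [Set.mem_setOf_eq]; omega)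
    (by simp only [Set.mem_setOf_eq]; omega) this

end Steps

/-! ### Neighbouring centres and the side line: transversality signs -/

/-- Antisymmetry of the side functional in the segment. [folklore] -/
theorem segSide_swap (ℓ r z : ℂ) : segSide r ℓ z = -segSide ℓ r z := by
  rw [segSide_eq, segSide_eq]; ring

/-- **The centre of the face across another side is on the positive side**: for `j' ≠ j`,
`segSide x_{j+2} x_{j+1} (centre of oppFace F j') = √3/3 > 0` (the anticlockwise vertices `x`
of `F`). [folklore] -/
theorem segSide_faceVertex_hexCenter_oppFace_of_ne (F : HexVertex) {j j' : Fin 3} (hj : j' ≠ j) :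
    segSide (triEmbed (faceVertex F (j + 2))) (triEmbed (faceVertex F (j + 1))) (hexCenter (oppFace F j')) =
      Real.sqrt 3 / 3 := by
  have h3 : Real.sqrt 3 * Real.sqrt 3 = 3 := Real.mul_self_sqrt (by norm_num)
  rcases F with ⟨x, t⟩
  obtain rfl | rfl : t = 0 ∨ t = 1 := by
    rcases Fin.exists_fin_two.1 ⟨t, rfl⟩ with h' | h'
    · exact Or.inl h'
    · exact Or.inr h'
  all_goals obtain rfl | rfl | rfl : j = 0 ∨ j = 1 ∨ j = 2 := by fin_cases j <;> simp
  all_goals obtain rfl | rfl | rfl : j' = 0 ∨ j' = 1 ∨ j' = 2 := by fin_cases j' <;> simp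
  all_goals first | exact absurd rfl hj | skip
  all_goals
    rw [segSide_eq]
    simp only [oppFace, faceVertex, Fin.isValue, ↓reduceIte, one_ne_zero, Matrix.cons_val_zero, Matrix.cons_val_one,
      Matrix.cons_val_two, Matrix.head_cons, Matrix.tail_cons, hexCenter_re, hexCenter_im, triEmbed_re, triEmbed_im,
      zero_add, Fin.val_zero, Fin.val_one]
    simp
    nlinarith [h3]

section SidePoints

variable {ω : SiteConfig (Site 2)} {f₀ : HexVertex} {w : hexGraph.Walk f₀ f₀}
  (hw : IsSiteInterfaceLoop ω w) (δ : ℝ)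

include hw

/-! ### Side points, side segments, midpoints at mesh `δ` -/

/-- The **left point** of the `i`-th step at mesh `δ`: its (open) left site. [folklore] -/
def IsSiteInterfaceLoop.leftPt (i : ℕ) : ℂ := triMeshPoint δ (hw.lv i)

/-- The **right point** of the `i`-th step at mesh `δ`: its (closed) right site. [folklore] -/
def IsSiteInterfaceLoop.rightPt (i : ℕ) : ℂ := triMeshPoint δ (hw.rv i)

/-- The **side segment** of the `i`-th step at mesh `δ`: the crossed edge of `δ𝕋`, from the left
point to the right point. [folklore] -/
def IsSiteInterfaceLoop.sideSeg (i : ℕ) : Set ℂ := segment ℝ (hw.leftPt δ i) (hw.rightPt δ i)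

variable {δ}

/-- **A unit edge of `δ𝕋` (or a lattice point) meeting a dart piece is the crossed edge of that
step.** [folklore] -/
theorem IsSiteInterfaceLoop.eq_lv_rv_of_inter (hδ : 0 < δ) {a b : Site 2} (hab : a = b ∨ triGraph.Adj a b)
    {i : ℕ} (hi : i < w.length) {q : ℂ} (hq1 : q ∈ segment ℝ (triMeshPoint δ a) (triMeshPoint δ b))
    (hq2 : q ∈ polyPiece δ w i) : (a = hw.rv i ∧ b = hw.lv i) ∨ (a = hw.lv i ∧ b = hw.rv i) := by
  rw [triMeshPoint, triMeshPoint, mem_segment_mul_iff hδ.ne'] at hq1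
  rw [polyPiece, polyPt, polyPt, mem_segment_mul_iff hδ.ne', hw.getVert_succ_eq hi] at hq2
  rcases eq_side_of_segment_inter_segment_hexCenter hab hq1 hq2 with ⟨ha, hb⟩ | ⟨ha, hb⟩
  · left; exact ⟨ha.trans (hw.rv_eq hi).symm, hb.trans (hw.lv_eq hi).symm⟩
  · right; exact ⟨ha.trans (hw.lv_eq hi).symm, hb.trans (hw.rv_eq hi).symm⟩

/-- **Lattice points are off the dart pieces.** [folklore] -/
theorem IsSiteInterfaceLoop.triMeshPoint_not_mem_polyPiece (hδ : 0 < δ) (a : Site 2) {i : ℕ} (hi : i < w.length) :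
    triMeshPoint δ a ∉ polyPiece δ w i := by
  intro h
  rcases hw.eq_lv_rv_of_inter hδ (Or.inl rfl) hi (left_mem_segment ℝ _ (triMeshPoint δ a)) h with
    ⟨h1, h2⟩ | ⟨h1, h2⟩
  · exact hw.lv_ne_rv hi hi (h2.symm.trans h1)
  · exact hw.lv_ne_rv hi hi (h1.symm.trans h2)

/-- **Lattice points are off the trace.** [folklore] -/
theorem IsSiteInterfaceLoop.triMeshPoint_not_mem_polyTrace (hδ : 0 < δ) (a : Site 2) :
    triMeshPoint δ a ∉ polyTrace δ w := by
  intro h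
  obtain ⟨i, hi, h⟩ := mem_polyTrace_iff.1 h
  exact hw.triMeshPoint_not_mem_polyPiece hδ a hi h

/-- The left point is off the trace. [folklore] -/
theorem IsSiteInterfaceLoop.leftPt_not_mem_polyTrace (hδ : 0 < δ) (m : ℕ) : hw.leftPt δ m ∉ polyTrace δ w :=
  hw.triMeshPoint_not_mem_polyTrace hδ _

/-- **An edge of `δ𝕋` between two open sites (or an open lattice point) misses the trace**: a
crossed edge has a closed endpoint. [folklore] -/
theorem IsSiteInterfaceLoop.segment_disjoint_polyTrace_of_mem (hδ : 0 < δ) {a b : Site 2}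
    (hab : a = b ∨ triGraph.Adj a b) (ha : a ∈ ω) (hb : b ∈ ω) :
    Disjoint (segment ℝ (triMeshPoint δ a) (triMeshPoint δ b)) (polyTrace δ w) := by
  refine disjoint_left.2 fun q hq1 hq ↦ ?_
  obtain ⟨i, hi, hq2⟩ := mem_polyTrace_iff.1 hq
  rcases hw.eq_lv_rv_of_inter hδ hab hi hq1 hq2 with ⟨h1, -⟩ | ⟨-, h2⟩
  · exact hw.rv_not_mem hi (h1 ▸ ha)
  · exact hw.rv_not_mem hi (h2 ▸ hb)

/-- **Consecutive left points are joined off the trace** (by a point or an open–open edge).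
[folklore] -/
theorem IsSiteInterfaceLoop.segment_leftPt_disjoint_polyTrace (hδ : 0 < δ) {i : ℕ} (hi : i + 1 < w.length) :
    Disjoint (segment ℝ (hw.leftPt δ i) (hw.leftPt δ (i + 1))) (polyTrace δ w) := by
  refine hw.segment_disjoint_polyTrace_of_mem hδ ?_ (hw.lv_mem (by omega)) (hw.lv_mem hi)
  rcases hw.lv_succ_eq_or_adj hi with h | h
  · exact Or.inl h.symm
  · exact Or.inr h

/-- **Only the `m`-th dart piece meets the `m`-th side segment**: other pieces miss it.
[folklore] -/
theorem IsSiteInterfaceLoop.polyPiece_disjoint_sideSeg (hδ : 0 < δ) {i m : ℕ} (hi : i < w.length)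
    (hm : m < w.length) (him : i ≠ m) : Disjoint (polyPiece δ w i) (hw.sideSeg δ m) := by
  refine disjoint_left.2 fun q hq2 hq1 ↦ him ?_
  rcases hw.eq_lv_rv_of_inter hδ (Or.inr (hw.adj_lv_rv hm)) hi hq1 hq2 with ⟨h1, -⟩ | ⟨h1, h2⟩
  · exact absurd h1 (hw.lv_ne_rv hm hi)
  · exact (hw.eq_of_lv_eq_of_rv_eq hm hi h1 h2).symm

/-- **The `i`-th piece meets its side segment only at their common midpoint**: a point of the
rescaled edge of `H` on the rescaled crossed side has an integral lattice form (the type form of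
the side), hence is the midpoint (`eq_midpoint_of_mem_segment_hexCenter_oppFace`). [folklore] -/
theorem IsSiteInterfaceLoop.eq_midpoint_of_mem_polyPiece_of_mem_sideSeg (hδ : 0 < δ) {i : ℕ} (hi : i < w.length)
    {q : ℂ} (hq1 : q ∈ polyPiece δ w i) (hq2 : q ∈ hw.sideSeg δ i) :
    q = (δ : ℂ) * midpoint ℝ (hexCenter (w.getVert i)) (hexCenter (w.getVert (i + 1))) := by
  set F := w.getVert i with hF
  set J := hw.sideIdx i with hJ
  rw [polyPiece, polyPt, polyPt, mem_segment_mul_iff hδ.ne', hw.getVert_succ_eq hi] at hq1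
  rw [IsSiteInterfaceLoop.sideSeg, IsSiteInterfaceLoop.leftPt, IsSiteInterfaceLoop.rightPt, triMeshPoint,
    triMeshPoint, mem_segment_mul_iff hδ.ne', hw.lv_eq hi, hw.rv_eq hi] at hq2
  -- the side from `x_{J+1}` to `x_{J+2}` is the unit edge `[a, a + dir k]`
  have hside : faceVertex F (J + 2) = faceVertex F (J + 1) + triDir (faceDartDir F (J + 1)) := by
    rw [← faceVertex_succ]
    congr 1
    rw [add_assoc]; rfl
  rw [segment_symm, hside] at hq2
  have hint := lform_ltype_of_mem_unitEdge hq2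
  rw [lform_triEmbed] at hint
  have key := eq_midpoint_of_mem_segment_hexCenter_oppFace hq1 hint
  rw [hw.getVert_succ_eq hi, midpoint_hexCenter_oppFace]
  have hsc : q = (δ : ℂ) * ((δ⁻¹ : ℝ) • q) := by
    rw [Complex.real_smul, Complex.ofReal_inv, ← mul_assoc, mul_inv_cancel₀ (Complex.ofReal_ne_zero.2 hδ.ne'), one_mul]
  rw [hsc, key]

/-- **The half side from the left point to the midpoint is off the trace** (except the midpoint
itself): the touching segment of the left (open) hexagon. [folklore] -/
theorem IsSiteInterfaceLoop.not_mem_polyTrace_of_mem_segment_leftPt (hδ : 0 < δ) {i : ℕ} (hi : i < w.length)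
    {q : ℂ} (hq : q ∈ segment ℝ (hw.leftPt δ i) ((δ : ℂ) * midpoint ℝ (hexCenter (w.getVert i)) (hexCenter (w.getVert (i + 1)))))
    (hne : q ≠ (δ : ℂ) * midpoint ℝ (hexCenter (w.getVert i)) (hexCenter (w.getVert (i + 1)))) :
    q ∉ polyTrace δ w := by
  -- the midpoint lies on the side segment, so the half side is part of it
  have hmid : (δ : ℂ) * midpoint ℝ (hexCenter (w.getVert i)) (hexCenter (w.getVert (i + 1))) ∈ hw.sideSeg δ i := by
    rw [IsSiteInterfaceLoop.sideSeg, IsSiteInterfaceLoop.leftPt, IsSiteInterfaceLoop.rightPt, triMeshPoint, triMeshPoint,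
      mem_segment_mul_iff hδ.ne', hw.lv_eq hi, hw.rv_eq hi, hw.getVert_succ_eq hi, midpoint_hexCenter_oppFace,
      Complex.real_smul, Complex.ofReal_inv, ← mul_assoc, inv_mul_cancel₀ (Complex.ofReal_ne_zero.2 hδ.ne'), one_mul,
      segment_symm]
    exact midpoint_mem_segment _ _
  have hqside : q ∈ hw.sideSeg δ i :=
    (convex_segment _ _).segment_subset (left_mem_segment _ _ _) hmid hq
  intro hqt
  obtain ⟨j, hj, hqj⟩ := mem_polyTrace_iff.1 hqt
  by_cases hji : j = i
  · subst hji
    exact hne (hw.eq_midpoint_of_mem_polyPiece_of_mem_sideSeg hδ hj hqj hqside)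
  · exact disjoint_left.1 (hw.polyPiece_disjoint_sideSeg hδ hj hi hji) hqj hqside

/-! ### Metric bookkeeping -/

/-- **Both ends of a dart piece are within `δ` of its left point.** [folklore] -/
theorem IsSiteInterfaceLoop.dist_polyPt_leftPt_le (hδ : 0 ≤ δ) {i : ℕ} (hi : i < w.length) :
    dist (polyPt δ w i) (hw.leftPt δ i) ≤ δ ∧ dist (polyPt δ w (i + 1)) (hw.leftPt δ i) ≤ δ := by
  obtain ⟨h, hfaces, -⟩ := hw.dart_spec hi
  obtain ⟨h1, h2⟩ := hexCenter_triEdgeFaces_mem_closedBall hδ ⟨(hw.lv i, hw.rv i), h⟩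
  rw [hfaces] at h1 h2
  exact ⟨h2, h1⟩

/-- The side segment has length `δ`. [folklore] -/
theorem IsSiteInterfaceLoop.dist_leftPt_rightPt (hδ : 0 ≤ δ) {i : ℕ} (hi : i < w.length) :
    dist (hw.leftPt δ i) (hw.rightPt δ i) = δ := by
  have h1 := (triGraph_adj_iff_dist_holds _ _).1 (hw.adj_lv_rv hi)
  rw [IsSiteInterfaceLoop.leftPt, IsSiteInterfaceLoop.rightPt, triMeshPoint, triMeshPoint, dist_eq_norm,
    ← mul_sub, norm_mul, Complex.norm_real, Real.norm_eq_abs, abs_of_nonneg hδ, h1, mul_one]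

/-- A dart piece lies in the `δ`-ball about its left point. [folklore] -/
theorem IsSiteInterfaceLoop.polyPiece_subset_closedBall (hδ : 0 ≤ δ) {i : ℕ} (hi : i < w.length) :
    polyPiece δ w i ⊆ closedBall (hw.leftPt δ i) δ := by
  obtain ⟨h1, h2⟩ := hw.dist_polyPt_leftPt_le hδ hi
  exact (convex_closedBall _ _).segment_subset (mem_closedBall.2 h1) (mem_closedBall.2 h2)

/-- Consecutive left points are within `δ`. [folklore] -/
theorem IsSiteInterfaceLoop.dist_leftPt_succ_le (hδ : 0 ≤ δ) {i : ℕ} (hi : i + 1 < w.length) :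
    dist (hw.leftPt δ i) (hw.leftPt δ (i + 1)) ≤ δ := by
  refine dist_triMeshPoint_le_of_eq_or_adj hδ ?_
  rcases hw.lv_succ_eq_or_adj hi with h | h
  exacts [Or.inl h.symm, Or.inr h]

/-! ### Chains of left points stay in one component -/

/-- **Left points of a stretch lie in one component.** If the `δ`-neighbourhoods of the left
points of the steps `i₀, …, i₁` lie in the set `A`, then in `A` minus the trace all these left
points lie in the component of any one of them (consecutive ones are joined by a point or an
open–open edge of `δ𝕋`, off the trace). [folklore] -/
theorem IsSiteInterfaceLoop.leftPt_mem_connectedComponentIn (hδ : 0 < δ) {A : Set ℂ} {i₀ i₁ : ℕ} (hi₁ : i₁ < w.length)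
    (hball : ∀ i, i₀ ≤ i → i ≤ i₁ → closedBall (hw.leftPt δ i) δ ⊆ A)
    {i m : ℕ} (hi₀ : i₀ ≤ i) (hi : i ≤ i₁) (hm₀ : i₀ ≤ m) (hm : m ≤ i₁) :
    hw.leftPt δ i ∈ connectedComponentIn (A \ polyTrace δ w) (hw.leftPt δ m) := by
  have key : ∀ k, i₀ + k ≤ i₁ → connectedComponentIn (A \ polyTrace δ w) (hw.leftPt δ (i₀ + k)) =
      connectedComponentIn (A \ polyTrace δ w) (hw.leftPt δ i₀) := by
    intro k
    induction k with
    | zero => intro; rfl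
    | succ k ih =>
      intro hk
      rw [← ih (by omega), show i₀ + (k + 1) = i₀ + k + 1 by omega]
      refine connectedComponentIn_eq ?_
      have hseg : segment ℝ (hw.leftPt δ (i₀ + k)) (hw.leftPt δ (i₀ + k + 1)) ⊆ A \ polyTrace δ w := by
        intro z hz
        refine ⟨hball (i₀ + k) (by omega) (by omega) ?_,
          disjoint_left.1 (hw.segment_leftPt_disjoint_polyTrace hδ (i := i₀ + k) (by omega)) hz⟩
        have h := hw.dist_leftPt_succ_le hδ.le (i := i₀ + k) (by omega)
        exact (convex_closedBall _ _).segment_subset (mem_closedBall_self hδ.le)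
          (mem_closedBall.2 (by rw [dist_comm]; exact h)) hz
      have hconn : IsPreconnected (segment ℝ (hw.leftPt δ (i₀ + k)) (hw.leftPt δ (i₀ + k + 1))) :=
        (convex_segment _ _).isPreconnected
      exact hconn.subset_connectedComponentIn (right_mem_segment _ _ _) hseg (left_mem_segment _ _ _)
  obtain ⟨k, rfl⟩ : ∃ k, i = i₀ + k := ⟨i - i₀, by omega⟩
  obtain ⟨k', rfl⟩ : ∃ k', m = i₀ + k' := ⟨m - i₀, by omega⟩
  have h1 := key k (by omega)
  have h2 := key k' (by omega)
  have hmem : hw.leftPt δ (i₀ + k) ∈ connectedComponentIn (A \ polyTrace δ w) (hw.leftPt δ (i₀ + k)) :=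
    mem_connectedComponentIn ⟨hball (i₀ + k) (by omega) (by omega) (mem_closedBall_self hδ.le),
      hw.leftPt_not_mem_polyTrace hδ _⟩
  rw [h1, ← h2] at hmem
  exact hmem

/-! ### Transversality signs at mesh `δ` -/

/-- The start of the `i`-th piece is on the positive side of the `i`-th side segment. [folklore] -/
theorem IsSiteInterfaceLoop.segSide_polyPt_pos (hδ : 0 < δ) {i : ℕ} (hi : i < w.length) :
    0 < segSide (hw.leftPt δ i) (hw.rightPt δ i) (polyPt δ w i) := by
  rw [IsSiteInterfaceLoop.leftPt, IsSiteInterfaceLoop.rightPt, triMeshPoint, triMeshPoint, polyPt, segSide_real_mul,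
    hw.lv_eq hi, hw.rv_eq hi, segSide_faceVertex_hexCenter]
  positivity

/-- The end of the `i`-th piece is on the negative side of the `i`-th side segment. [folklore] -/
theorem IsSiteInterfaceLoop.segSide_polyPt_succ_neg (hδ : 0 < δ) {i : ℕ} (hi : i < w.length) :
    segSide (hw.leftPt δ i) (hw.rightPt δ i) (polyPt δ w (i + 1)) < 0 := by
  rw [IsSiteInterfaceLoop.leftPt, IsSiteInterfaceLoop.rightPt, triMeshPoint, triMeshPoint, polyPt, segSide_real_mul,
    hw.lv_eq hi, hw.rv_eq hi, hw.getVert_succ_eq hi, segSide_faceVertex_hexCenter_oppFace]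
  have : 0 < Real.sqrt 3 / 6 := by positivity
  have hδ2 : 0 < δ ^ 2 := by positivity
  nlinarith

/-- **The previous vertex is on the positive side**: if `1 ≤ i` and the faces `i - 1` and `i + 1`
differ, the start of the `(i-1)`-st piece is on the positive side of the `i`-th side segment.
[folklore] -/
theorem IsSiteInterfaceLoop.segSide_polyPt_pred_pos (hδ : 0 < δ) {i : ℕ} (hi1 : 1 ≤ i) (hi : i < w.length)
    (hne : w.getVert (i - 1) ≠ w.getVert (i + 1)) :
    0 < segSide (hw.leftPt δ i) (hw.rightPt δ i) (polyPt δ w (i - 1)) := by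
  -- face `i - 1` is a neighbour of face `i` across a side other than `sideIdx i`
  have hadj : hexGraph.Adj (w.getVert i) (w.getVert (i - 1)) := by
    have := w.adj_getVert_succ (i := i - 1) (by omega)
    rw [show i - 1 + 1 = i by omega] at this
    exact this.symm
  obtain ⟨j', hj'⟩ := exists_oppFace_eq_of_hexGraph_adj hadj
  have hjne : j' ≠ hw.sideIdx i := by
    intro h
    apply hne
    rw [hj', h, ← hw.getVert_succ_eq hi]
  rw [IsSiteInterfaceLoop.leftPt, IsSiteInterfaceLoop.rightPt, triMeshPoint, triMeshPoint, polyPt, segSide_real_mul,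
    hw.lv_eq hi, hw.rv_eq hi, hj', segSide_faceVertex_hexCenter_oppFace_of_ne _ hjne]
  positivity

/-- **The vertex after next is on the negative side**: if the faces `i` and `i + 2` differ, the
end of the `(i+1)`-st piece is on the negative side of the `i`-th side segment (seen from the
next face, the crossed side is read clockwise). [folklore] -/
theorem IsSiteInterfaceLoop.segSide_polyPt_succ_succ_neg (hδ : 0 < δ) {i : ℕ} (hi : i + 1 < w.length)
    (hne : w.getVert (i + 2) ≠ w.getVert i) :
    segSide (hw.leftPt δ i) (hw.rightPt δ i) (polyPt δ w (i + 2)) < 0 := by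
  have hi' : i < w.length := by omega
  -- the crossed dart reversed: right face `G = getVert (i+1)`, left face `getVert i`
  obtain ⟨h, hfaces, -⟩ := hw.dart_spec hi'
  set G := w.getVert (i + 1) with hG
  have hsymm := triEdgeFaces_symm_holds (⟨(hw.lv i, hw.rv i), h⟩ : triGraph.Dart)
  rw [hfaces] at hsymm
  -- `hsymm : triEdgeFaces ⟨(rv, lv), _⟩ = (getVert i, G)`
  have hrev : (⟨(hw.lv i, hw.rv i), h⟩ : triGraph.Dart).symm = ⟨(hw.rv i, hw.lv i), h.symm⟩ := rfl
  rw [hrev] at hsymm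
  obtain ⟨J', h1, h2, h3⟩ := exists_sideIdx_of_triEdgeFaces h.symm
  have hR : (triEdgeFaces ⟨(hw.rv i, hw.lv i), h.symm⟩).2 = G := by rw [hsymm]; rfl
  have hL : (triEdgeFaces ⟨(hw.rv i, hw.lv i), h.symm⟩).1 = w.getVert i := by rw [hsymm]; rfl
  rw [hR] at h1 h2 h3
  rw [hL] at h1
  -- `h1 : getVert i = oppFace G J'`, `h2 : lv i = faceVertex G (J'+1)`, `h3 : rv i = faceVertex G (J'+2)`
  -- face `i + 2` is a neighbour of `G` across a side other than `J'`
  obtain ⟨j'', hj''⟩ := exists_oppFace_eq_of_hexGraph_adj (w.adj_getVert_succ hi)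
  have hjne : j'' ≠ J' := by
    intro hh
    apply hne
    rw [show i + 2 = i + 1 + 1 by omega, hj'', hh, ← h1]
  rw [IsSiteInterfaceLoop.leftPt, IsSiteInterfaceLoop.rightPt, triMeshPoint, triMeshPoint, polyPt, segSide_real_mul,
    h2, h3, show i + 2 = i + 1 + 1 by omega, hj'', segSide_swap,
    segSide_faceVertex_hexCenter_oppFace_of_ne _ hjne]
  have : 0 < Real.sqrt 3 / 3 := by positivity
  have hδ2 : 0 < δ ^ 2 := by positivity
  nlinarith

end SidePoints

end Literature.Probability.Percolation
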